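import Mathlib
import Summits.NavierStokesRegularity.NavierStokesRegularity.Theorems.TaoLadderRungTwoFlatExistCapture
import Literature.Analysis.FluidPDE.Tao2016AveragedNS.WeightedLatticeFlowsOn
import HarnessLib

/-!
# THE CONCRETE BANACH WEIGHT OF THE EXISTENCE CLAUSE: `ω_k := max(1, (1+ε₀)^{10k})` is admissible for the continuation criterion on `S♭`
  (ratio bound `A = (1+ε₀)^{25/2}`, a-priori compatibility `D = 2`), dominates the clocks, is dominated by the Gaussian tube weight, is
  window-regular against the clocks, bounded below by `1` and above by `1` behind, with neighbour ratios `(1+ε₀)^{10}` — the weight rows of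
  `tubeExistWith_of_phases` / `apriori_tube_of_levels` / `apriori_capture_of_continuity` discharged once and for all
  (helper for the K_A♭ parent item stmt-NavierStokesRegularity-22987 `FlatGapCertificatesV2`, child 2A `GradedAdiabaticWakeA` of route
  TaoLadderRungTwoFlat; cell harvest/h2-tao-ladder, p1 g25; LADDER §47.5 L2, §50 K4)

* `banach_ratios` — `WeightRatiosLEOn shiftSetFlat ε₀ (fun k => max 1 ((1+ε₀)^{10k})) ((1+ε₀)^{25/2})`;
* `banach_apriori` — `(1 + (1+ε₀)^{10k}) / ω_k ≤ 2`;
* `clockW_le_banach`, `banach_windowRegular` (`ω/c` window-regular with `Λ = (1+ε₀)^{25/2}`), `banach_ratio_up`, `banach_ratio_down`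
  (`ω_k ≤ (1+ε₀)^{10}·ω_{k∓1}`), `one_le_banach`, `banach_of_neg` (`ω_k = 1` for `k < 0`), `banach_le_pow_of_lt` (`ω_k ≤ (1+ε₀)^{10K}` for `k < K`,
  `K ≥ 0`), `banach_le_tubeWeight` (`ω ≤ tubeWeight C b` when `C ≥ 1`, `b ≥ 0`, `(1+ε₀)^{10} ≤ 2^{b + 1/2}`).

HONEST FRAMING: elementary real-number facts (MODEL lattice bookkeeping); nothing certified; no item closed; nothing about the Navier–Stokes equations.
-/

noncomputable section

-- the sub-problem namespace repeats the summit name by design (D-0017)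
set_option linter.dupNamespace false

namespace Summit.NavierStokesRegularity.NavierStokesRegularity.Theorems.HopTube

open Set Finset Literature.Analysis.FluidPDE Literature.Analysis.FluidPDE.TaoCascade MirrorPulse RenormFrame QuadPolar

variable {ε₀ : ℝ}

/-- `ω ≥ 1`. [folklore] -/
theorem one_le_banach (ε₀ : ℝ) (k : ℤ) : 1 ≤ max 1 ((1 + ε₀) ^ ((10 : ℝ) * k)) := le_max_left _ _

/-- Behind the front the weight is `1`. [folklore] -/
theorem banach_of_nonpos (hε₀ : 0 ≤ ε₀) {k : ℤ} (hk : k ≤ 0) : max 1 ((1 + ε₀) ^ ((10 : ℝ) * k)) = 1 := by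
  apply max_eq_left
  apply Real.rpow_le_one_of_one_le_of_nonpos (by linarith)
  have : (k : ℝ) ≤ 0 := by exact_mod_cast hk
  linarith

/-- Ahead of the front the weight is `(1+ε₀)^{10k}`. [folklore] -/
theorem banach_of_nonneg (hε₀ : 0 ≤ ε₀) {k : ℤ} (hk : 0 ≤ k) : max 1 ((1 + ε₀) ^ ((10 : ℝ) * k)) = (1 + ε₀) ^ ((10 : ℝ) * k) := by
  apply max_eq_right
  apply Real.one_le_rpow (by linarith)
  have : (0 : ℝ) ≤ k := by exact_mod_cast hk
  positivity

/-- The weight is a power with a clipped exponent: `ω_k = (1+ε₀)^{10·max(k,0)}`. [folklore] -/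
theorem banach_eq_rpow_max (hε₀ : 0 ≤ ε₀) (k : ℤ) :
    max 1 ((1 + ε₀) ^ ((10 : ℝ) * k)) = (1 + ε₀) ^ ((10 : ℝ) * ((max k 0 : ℤ) : ℝ)) := by
  rcases le_or_gt 0 k with hk | hk
  · rw [banach_of_nonneg hε₀ hk, max_eq_left hk]
  · rw [banach_of_nonpos hε₀ hk.le, max_eq_right hk.le]; simp

/-- **A-priori compatibility** `(1 + (1+ε₀)^{10k})/ω_k ≤ 2` (membership in the Banach space implies the format's (4.5)). [cite: Tao2016AveragedNS, §4 Lemma 4.1 (4.5), (4.12)] -/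
theorem banach_apriori (ε₀ : ℝ) (k : ℤ) :
    (1 + (1 + ε₀) ^ ((10 : ℝ) * k)) / max 1 ((1 + ε₀) ^ ((10 : ℝ) * k)) ≤ 2 := by
  have hpos : 0 < max 1 ((1 + ε₀) ^ ((10 : ℝ) * k)) := lt_of_lt_of_le one_pos (le_max_left _ _)
  rw [div_le_iff₀ hpos]
  have h1 : (1 : ℝ) ≤ max 1 ((1 + ε₀) ^ ((10 : ℝ) * k)) := le_max_left _ _
  have h2 : (1 + ε₀) ^ ((10 : ℝ) * k) ≤ max 1 ((1 + ε₀) ^ ((10 : ℝ) * k)) := le_max_right _ _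
  linarith

/-- The weight dominates the clock: `c_k ≤ ω_k`. [cite: Tao2016AveragedNS, §4 (4.8)] -/
theorem clockW_le_banach (hε₀ : 0 ≤ ε₀) (k : ℤ) : clockW ε₀ k ≤ max 1 ((1 + ε₀) ^ ((10 : ℝ) * k)) := by
  have h1 : (1 : ℝ) ≤ 1 + ε₀ := by linarith
  unfold clockW
  rcases le_or_gt 0 k with hk | hk
  · refine le_trans ?_ (le_max_right _ _)
    have : (0 : ℝ) ≤ k := by exact_mod_cast hk
    exact Real.rpow_le_rpow_of_exponent_le h1 (by linarith)
  · refine le_trans ?_ (le_max_left _ _)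
    have : (k : ℝ) ≤ 0 := by exact_mod_cast hk.le
    exact Real.rpow_le_one_of_one_le_of_nonpos h1 (by linarith)

/-- Neighbour ratio upward: `ω_k ≤ (1+ε₀)^{10}·ω_{k−1}`. [folklore] -/
theorem banach_ratio_up (hε₀ : 0 ≤ ε₀) (k : ℤ) :
    max 1 ((1 + ε₀) ^ ((10 : ℝ) * k)) ≤ (1 + ε₀) ^ (10 : ℝ) * max 1 ((1 + ε₀) ^ ((10 : ℝ) * ((k - 1 : ℤ) : ℝ))) := by
  have hq : 0 < 1 + ε₀ := by linarith
  have h10 : 1 ≤ (1 + ε₀) ^ (10 : ℝ) := Real.one_le_rpow (by linarith) (by norm_num)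
  apply max_le
  · calc (1 : ℝ) ≤ (1 + ε₀) ^ (10 : ℝ) * 1 := by linarith
      _ ≤ _ := mul_le_mul_of_nonneg_left (le_max_left _ _) (by positivity)
  · calc (1 + ε₀) ^ ((10 : ℝ) * k) = (1 + ε₀) ^ (10 : ℝ) * (1 + ε₀) ^ ((10 : ℝ) * ((k - 1 : ℤ) : ℝ)) := by
          rw [← Real.rpow_add hq]; congr 1; push_cast; ring
      _ ≤ _ := mul_le_mul_of_nonneg_left (le_max_right _ _) (by positivity)

/-- Neighbour ratio downward: `ω_k ≤ (1+ε₀)^{10}·ω_{k+1}` (indeed `ω_k ≤ ω_{k+1}`). [folklore] -/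
theorem banach_ratio_down (hε₀ : 0 ≤ ε₀) (k : ℤ) :
    max 1 ((1 + ε₀) ^ ((10 : ℝ) * k)) ≤ (1 + ε₀) ^ (10 : ℝ) * max 1 ((1 + ε₀) ^ ((10 : ℝ) * ((k + 1 : ℤ) : ℝ))) := by
  have hq : 0 < 1 + ε₀ := by linarith
  have h10 : 1 ≤ (1 + ε₀) ^ (10 : ℝ) := Real.one_le_rpow (by linarith) (by norm_num)
  have hmono : (1 + ε₀) ^ ((10 : ℝ) * k) ≤ (1 + ε₀) ^ ((10 : ℝ) * ((k + 1 : ℤ) : ℝ)) :=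
    Real.rpow_le_rpow_of_exponent_le (by linarith) (by push_cast; linarith)
  apply max_le
  · calc (1 : ℝ) ≤ (1 + ε₀) ^ (10 : ℝ) * 1 := by linarith
      _ ≤ _ := mul_le_mul_of_nonneg_left (le_max_left _ _) (by positivity)
  · calc (1 + ε₀) ^ ((10 : ℝ) * k) ≤ 1 * (1 + ε₀) ^ ((10 : ℝ) * ((k + 1 : ℤ) : ℝ)) := by rw [one_mul]; exact hmono
      _ ≤ (1 + ε₀) ^ (10 : ℝ) * max 1 ((1 + ε₀) ^ ((10 : ℝ) * ((k + 1 : ℤ) : ℝ))) :=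
          mul_le_mul h10 (le_max_right _ _) (by positivity) (by positivity)

/-- Below a shell `K ≥ 0` the weight is at most `(1+ε₀)^{10K}`. [folklore] -/
theorem banach_le_pow_of_lt (hε₀ : 0 ≤ ε₀) {K k : ℤ} (hK : 0 ≤ K) (hk : k < K) :
    max 1 ((1 + ε₀) ^ ((10 : ℝ) * k)) ≤ (1 + ε₀) ^ ((10 : ℝ) * K) := by
  have h1 : (1 : ℝ) ≤ 1 + ε₀ := by linarith
  have hKR : (0 : ℝ) ≤ K := by exact_mod_cast hK
  have hkR : (k : ℝ) ≤ K := by exact_mod_cast hk.le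
  apply max_le
  · exact Real.one_le_rpow h1 (by positivity)
  · exact Real.rpow_le_rpow_of_exponent_le h1 (by linarith)

/-- **`ω/c` is window-regular** with `Λ = (1+ε₀)^{25/2}`. [cite: Tao2016AveragedNS, §4 (4.8)] -/
theorem banach_windowRegular (hε₀ : 0 ≤ ε₀) :
    IsWindowRegular (fun (_ : Fin 2) k => max 1 ((1 + ε₀) ^ ((10 : ℝ) * k)) / clockW ε₀ k) ((1 + ε₀) ^ ((25 : ℝ) / 2)) := by
  have hq : 0 < 1 + ε₀ := by linarith
  have h1 : (1 : ℝ) ≤ 1 + ε₀ := by linarith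
  have hc : ∀ k, 0 < clockW ε₀ k := clockW_pos (by linarith)
  have hΛ1 : 1 ≤ (1 + ε₀) ^ ((25 : ℝ) / 2) := Real.one_le_rpow h1 (by norm_num)
  refine ⟨fun _ n => div_pos (lt_of_lt_of_le one_pos (le_max_left _ _)) (hc n), hΛ1, fun _ _ n k hk => ?_⟩
  -- `ω_n/c_n = (1+ε₀)^{10 max(n,0) − 5n/2}`; the exponent moves by at most `25/2` between neighbours
  show max 1 ((1 + ε₀) ^ ((10 : ℝ) * n)) / clockW ε₀ n ≤ (1 + ε₀) ^ ((25 : ℝ) / 2) * (max 1 ((1 + ε₀) ^ ((10 : ℝ) * k)) / clockW ε₀ k)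
  rw [banach_eq_rpow_max hε₀ n, banach_eq_rpow_max hε₀ k]
  unfold clockW
  rw [← Real.rpow_sub hq, ← Real.rpow_sub hq, ← Real.rpow_add hq]
  apply Real.rpow_le_rpow_of_exponent_le h1
  have hn' : ((max n 0 : ℤ) : ℝ) ≤ ((max k 0 : ℤ) : ℝ) + 1 := by
    have : max n 0 ≤ max k 0 + 1 := by omega
    exact_mod_cast this
  have hk' : (k : ℝ) ≤ n + 1 := by exact_mod_cast hk.2
  linarith

/-- **The weight ratios of the conjugated field on `S♭` are bounded**: `A = (1+ε₀)^{25/2}`. [cite: Tao2016AveragedNS, §4 (4.8), (4.12); cell vocabulary (`WeightRatiosLEOn`)] -/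
theorem banach_ratios (hε₀ : 0 ≤ ε₀) :
    WeightRatiosLEOn shiftSetFlat ε₀ (fun k => max 1 ((1 + ε₀) ^ ((10 : ℝ) * k))) ((1 + ε₀) ^ ((25 : ℝ) / 2)) := by
  have hq : 0 < 1 + ε₀ := by linarith
  have h1 : (1 : ℝ) ≤ 1 + ε₀ := by linarith
  refine ⟨fun k => lt_of_lt_of_le one_pos (le_max_left _ _), fun k μ hμ => ?_⟩
  obtain ⟨hμ1, hμ2, hμ3⟩ := isNearestNeighbourSet_shiftSetFlat μ hμ
  have hpos : ∀ m : ℤ, 0 < max 1 ((1 + ε₀) ^ ((10 : ℝ) * m)) := fun m => lt_of_lt_of_le one_pos (le_max_left _ _)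
  dsimp only
  rw [div_le_iff₀ (mul_pos (hpos _) (hpos _))]
  rw [banach_eq_rpow_max hε₀ k, banach_eq_rpow_max hε₀ (k - μ.2.2 + μ.1), banach_eq_rpow_max hε₀ (k - μ.2.2 + μ.2.1),
    ← Real.rpow_add hq, ← Real.rpow_add hq, ← Real.rpow_add hq]
  apply Real.rpow_le_rpow_of_exponent_le h1
  -- exponent bookkeeping: `2.5(k−μ₃) + 10k⁺ ≤ 12.5 + 10a⁺ + 10b⁺`
  have hμ1' : (μ.1 : ℝ) = 0 ∨ (μ.1 : ℝ) = 1 := by rcases hμ1 with h | h <;> simp [h]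
  have hμ2' : (μ.2.1 : ℝ) = 0 ∨ (μ.2.1 : ℝ) = 1 := by rcases hμ2 with h | h <;> simp [h]
  have hμ3' : (μ.2.2 : ℝ) = 0 ∨ (μ.2.2 : ℝ) = 1 := by rcases hμ3 with h | h <;> simp [h]
  rcases le_or_gt k 0 with hk | hk
  · have e0 : ((max k 0 : ℤ) : ℝ) = 0 := by rw [max_eq_right hk]; simp
    have ha : (0 : ℝ) ≤ ((max (k - μ.2.2 + μ.1) 0 : ℤ) : ℝ) := by exact_mod_cast le_max_right _ _
    have hb : (0 : ℝ) ≤ ((max (k - μ.2.2 + μ.2.1) 0 : ℤ) : ℝ) := by exact_mod_cast le_max_right _ _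
    have hkR : (k : ℝ) ≤ 0 := by exact_mod_cast hk
    rw [e0]
    rcases hμ3' with h3 | h3 <;> rw [h3] <;> nlinarith
  · have e0 : ((max k 0 : ℤ) : ℝ) = k := by rw [max_eq_left hk.le]
    have ea : ((max (k - μ.2.2 + μ.1) 0 : ℤ) : ℝ) = (k : ℝ) - μ.2.2 + μ.1 := by
      rw [max_eq_left (by rcases hμ1 with h | h <;> rcases hμ3 with h' | h' <;> omega)]; push_cast; ring
    have eb : ((max (k - μ.2.2 + μ.2.1) 0 : ℤ) : ℝ) = (k : ℝ) - μ.2.2 + μ.2.1 := by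
      rw [max_eq_left (by rcases hμ2 with h | h <;> rcases hμ3 with h' | h' <;> omega)]; push_cast; ring
    have hkR : (1 : ℝ) ≤ k := by exact_mod_cast hk
    rw [e0, ea, eb]
    rcases hμ1' with h1' | h1' <;> rcases hμ2' with h2' | h2' <;> rcases hμ3' with h3' | h3' <;> rw [h1', h2', h3'] <;> nlinarith

/-- **The weight is dominated by the Gaussian tube weight** (`C ≥ 1`, `b ≥ 0`, `(1+ε₀)^{10} ≤ 2^{b + 1/2}`): `ω_k ≤ tubeWeight C b k`.
[folklore; cell LADDER §50 (tube weight)] -/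
theorem banach_le_tubeWeight (hε₀ : 0 ≤ ε₀) {C b : ℝ} (hC : 1 ≤ C) (hb : 0 ≤ b) (hq : (1 + ε₀) ^ (10 : ℝ) ≤ (2 : ℝ) ^ (b + 1 / 2))
    (k : ℤ) : max 1 ((1 + ε₀) ^ ((10 : ℝ) * k)) ≤ tubeWeight C b k := by
  have hpos : 0 < 1 + ε₀ := by linarith
  rcases lt_or_ge k 0 with hk | hk
  · rw [banach_of_nonpos hε₀ hk.le, tubeWeight_of_neg C b hk]; exact hC
  · rw [banach_of_nonneg hε₀ hk, tubeWeight_of_nonneg C b hk]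
    have hkR : (0 : ℝ) ≤ k := by exact_mod_cast hk
    -- `(1+ε₀)^{10k} = ((1+ε₀)^{10})^k ≤ (2^{b+1/2})^k = 2^{(b+1/2)k} ≤ 2^{k²/2 + bk}` for `k ≥ 1`; `k = 0` trivial
    have h1 : (1 + ε₀) ^ ((10 : ℝ) * k) = ((1 + ε₀) ^ (10 : ℝ)) ^ (k : ℝ) := by rw [← Real.rpow_mul hpos.le]
    have h2 : ((1 + ε₀) ^ (10 : ℝ)) ^ (k : ℝ) ≤ ((2 : ℝ) ^ (b + 1 / 2)) ^ (k : ℝ) :=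
      Real.rpow_le_rpow (by positivity) hq hkR
    have h3 : ((2 : ℝ) ^ (b + 1 / 2)) ^ (k : ℝ) = (2 : ℝ) ^ ((b + 1 / 2) * k) := by rw [← Real.rpow_mul (by norm_num)]
    have h4 : (2 : ℝ) ^ ((b + 1 / 2) * k) ≤ (2 : ℝ) ^ ((k : ℝ) ^ 2 / 2 + b * k) := by
      apply Real.rpow_le_rpow_of_exponent_le (by norm_num)
      rcases eq_or_lt_of_le hk with h0 | h0
      · have : (k : ℝ) = 0 := by exact_mod_cast h0.symm
        rw [this]; ring_nf; exact le_rfl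
      · have : (1 : ℝ) ≤ k := by exact_mod_cast h0
        nlinarith
    have h5 : (1 : ℝ) ≤ (2 : ℝ) ^ ((k : ℝ) ^ 2 / 2 + b * k) := Real.one_le_rpow (by norm_num) (by positivity)
    calc (1 + ε₀) ^ ((10 : ℝ) * k) ≤ (2 : ℝ) ^ ((k : ℝ) ^ 2 / 2 + b * k) := by rw [h1]; exact h2.trans (h3 ▸ h4)
      _ = 1 * (2 : ℝ) ^ ((k : ℝ) ^ 2 / 2 + b * k) := (one_mul _).symm
      _ ≤ C * (2 : ℝ) ^ ((k : ℝ) ^ 2 / 2 + b * k) := mul_le_mul_of_nonneg_right hC (by positivity)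

end Summit.NavierStokesRegularity.NavierStokesRegularity.Theorems.HopTube

end
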